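import Mathlib.Analysis.InnerProductSpace.Laplacian
import Mathlib.Analysis.Calculus.ContDiff.Bounds
import Mathlib.Analysis.InnerProductSpace.PiL2
import HarnessLib

/-!
# Sup-norm bookkeeping for ROUND-27 «THE √2 APEX» (T27-A′): from bounds on `D^n V` (`n ≤ 3`) and on the
# cut-off to bounds on `V, ΔV, Δ(φV), DΔ(φV)` (item `TerminalTrace.TypeITraceScarL3`,
# stmt-NavierStokesRegularity-18385, Stub LOUD line; helpers)

Seat nsreg-C26-p1 g2 (cell ns-regularity-ideate), `--supports stmt-NavierStokesRegularity-18385` (helper).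
Pure calculus on `ℝ³`: `‖Δf(y)‖ ≤ 3‖D²f(y)‖`, `‖D(Δf)(y)‖ ≤ 3‖D³f(y)‖`, the Leibniz bound
`‖Dⁿ(φV)(y)‖ ≤ 2ⁿ M_φ K` (`n ≤ 3`) from `‖Dⁱφ(y)‖ ≤ M_φ`, `‖DʲV(y)‖ ≤ K` (`i, j ≤ 3`; Mathlib
`norm_iteratedFDeriv_smul_le`), and the package `annulusBounds_of_iteratedFDeriv_le`:
`‖V‖, ‖ΔV‖, ‖Δ(φV)‖, ‖DΔ(φV)‖ ≤ (3 + 24 M_φ) K` at such a point — the form consumed by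
`two_le_rateSq_of_shellData` (`…SqrtTwoApexTimeLayer`), fed by the quiet-shell representative's bounds
`‖DⁿV‖ ≤ K'`, `n ≤ 4` (`exists_quietShell_representative`).

WHAT THIS IS NOT: not T27-A′, not NS — calculus.  [folklore]
-/

noncomputable section

set_option linter.dupNamespace false

namespace Summit.NavierStokesRegularity.NavierStokesRegularity.Theorems.TypeITraceScarL3

open Set Function Filter Topology InnerProductSpace
open scoped Laplacian ContDiff

variable {F : Type*} [NormedAddCommGroup F] [InnerProductSpace ℝ F]
  {f V : EuclideanSpace ℝ (Fin 3) → EuclideanSpace ℝ (Fin 3)} {φ : EuclideanSpace ℝ (Fin 3) → ℝ}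

/-- A second derivative applied to two unit frame vectors is bounded by its norm. -/
private theorem norm_apply_basis_pair_le
    (T : ContinuousMultilinearMap ℝ (fun _ : Fin 2 => EuclideanSpace ℝ (Fin 3)) F) (i : Fin 3) :
    ‖T ![EuclideanSpace.basisFun (Fin 3) ℝ i, EuclideanSpace.basisFun (Fin 3) ℝ i]‖ ≤ ‖T‖ := by
  have h := T.le_opNorm ![EuclideanSpace.basisFun (Fin 3) ℝ i, EuclideanSpace.basisFun (Fin 3) ℝ i]
  have h1 : ‖EuclideanSpace.basisFun (Fin 3) ℝ i‖ = 1 := (EuclideanSpace.basisFun (Fin 3) ℝ).orthonormal.1 i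
  rw [Fin.prod_univ_two] at h
  simp only [Matrix.cons_val_zero, Matrix.cons_val_one, h1, mul_one] at h
  exact h

/-- **`‖Δf(y)‖ ≤ 3 ‖D²f(y)‖`** (the Laplacian is the trace of the Hessian over the frame). [folklore] -/
theorem norm_laplacian_le_three_mul (g : EuclideanSpace ℝ (Fin 3) → F) (y : EuclideanSpace ℝ (Fin 3)) :
    ‖(Δ g) y‖ ≤ 3 * ‖iteratedFDeriv ℝ 2 g y‖ := by
  rw [laplacian_eq_iteratedFDeriv_orthonormalBasis g (EuclideanSpace.basisFun (Fin 3) ℝ)]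
  calc ‖∑ i, iteratedFDeriv ℝ 2 g y ![EuclideanSpace.basisFun (Fin 3) ℝ i, EuclideanSpace.basisFun (Fin 3) ℝ i]‖
      ≤ ∑ i, ‖iteratedFDeriv ℝ 2 g y ![EuclideanSpace.basisFun (Fin 3) ℝ i, EuclideanSpace.basisFun (Fin 3) ℝ i]‖ :=
        norm_sum_le _ _
    _ ≤ ∑ _i : Fin 3, ‖iteratedFDeriv ℝ 2 g y‖ :=
        Finset.sum_le_sum fun i _ => norm_apply_basis_pair_le _ i
    _ = 3 * ‖iteratedFDeriv ℝ 2 g y‖ := by simp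

/-- **`‖D(Δf)(y)‖ ≤ 3 ‖D³f(y)‖`** for smooth `f`. [folklore] -/
theorem norm_fderiv_laplacian_le_three_mul {g : EuclideanSpace ℝ (Fin 3) → F} (hg : ContDiff ℝ ∞ g)
    (y : EuclideanSpace ℝ (Fin 3)) : ‖fderiv ℝ (Δ g) y‖ ≤ 3 * ‖iteratedFDeriv ℝ 3 g y‖ := by
  set b := EuclideanSpace.basisFun (Fin 3) ℝ with hb
  have hd : DifferentiableAt ℝ (iteratedFDeriv ℝ 2 g) y :=
    ((hg.of_le (by norm_cast : (3 : WithTop ℕ∞) ≤ ∞)).differentiable_iteratedFDeriv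
      (by norm_cast : (2 : WithTop ℕ∞) < 3)) y
  -- the derivative of each term `x ↦ D²g(x)(bᵢ, bᵢ)`
  have hterm : ∀ i : Fin 3, HasFDerivAt (fun x => iteratedFDeriv ℝ 2 g x ![b i, b i])
      ((ContinuousMultilinearMap.apply ℝ (fun _ : Fin 2 => EuclideanSpace ℝ (Fin 3)) F ![b i, b i]).comp
        (fderiv ℝ (iteratedFDeriv ℝ 2 g) y)) y := fun i =>
    (ContinuousMultilinearMap.apply ℝ (fun _ : Fin 2 => EuclideanSpace ℝ (Fin 3)) F ![b i, b i]).hasFDerivAt.comp y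
      hd.hasFDerivAt
  have hsum : HasFDerivAt (Δ g)
      (∑ i, (ContinuousMultilinearMap.apply ℝ (fun _ : Fin 2 => EuclideanSpace ℝ (Fin 3)) F ![b i, b i]).comp
        (fderiv ℝ (iteratedFDeriv ℝ 2 g) y)) y := by
    rw [laplacian_eq_iteratedFDeriv_orthonormalBasis g b]
    exact HasFDerivAt.fun_sum fun i _ => hterm i
  rw [hsum.fderiv]
  refine ContinuousLinearMap.opNorm_le_bound _ (by positivity) fun v => ?_
  rw [_root_.sum_apply]
  calc ‖∑ i, ((ContinuousMultilinearMap.apply ℝ (fun _ : Fin 2 => EuclideanSpace ℝ (Fin 3)) F ![b i, b i]).comp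
          (fderiv ℝ (iteratedFDeriv ℝ 2 g) y)) v‖
      ≤ ∑ i, ‖((ContinuousMultilinearMap.apply ℝ (fun _ : Fin 2 => EuclideanSpace ℝ (Fin 3)) F ![b i, b i]).comp
          (fderiv ℝ (iteratedFDeriv ℝ 2 g) y)) v‖ := norm_sum_le _ _
    _ ≤ ∑ _i : Fin 3, ‖iteratedFDeriv ℝ 3 g y‖ * ‖v‖ := Finset.sum_le_sum fun i _ => by
        rw [ContinuousLinearMap.comp_apply, ContinuousMultilinearMap.apply_apply]
        calc ‖(fderiv ℝ (iteratedFDeriv ℝ 2 g) y v) ![b i, b i]‖ ≤ ‖fderiv ℝ (iteratedFDeriv ℝ 2 g) y v‖ :=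
              norm_apply_basis_pair_le _ i
          _ ≤ ‖fderiv ℝ (iteratedFDeriv ℝ 2 g) y‖ * ‖v‖ := ContinuousLinearMap.le_opNorm _ _
          _ = ‖iteratedFDeriv ℝ 3 g y‖ * ‖v‖ := by rw [norm_fderiv_iteratedFDeriv]
    _ = 3 * ‖iteratedFDeriv ℝ 3 g y‖ * ‖v‖ := by simp; ring

/-- **Leibniz bound** `‖Dⁿ(φV)(y)‖ ≤ 2ⁿ M_φ K` for `n ≤ 3`, from `‖Dⁱφ(y)‖ ≤ M_φ`, `‖DʲV(y)‖ ≤ K`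
(`i, j ≤ 3`). [folklore] -/
theorem norm_iteratedFDeriv_cutoff_le (hφ : ContDiff ℝ ∞ φ) (hV : ContDiff ℝ ∞ V) {Mφ K : ℝ}
    (hMφ : 0 ≤ Mφ) {y : EuclideanSpace ℝ (Fin 3)}
    (hφb : ∀ i ≤ 3, ‖iteratedFDeriv ℝ i φ y‖ ≤ Mφ) (hVb : ∀ j ≤ 3, ‖iteratedFDeriv ℝ j V y‖ ≤ K)
    {n : ℕ} (hn : n ≤ 3) :
    ‖iteratedFDeriv ℝ n (fun y => φ y • V y) y‖ ≤ 2 ^ n * Mφ * K := by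
  have h := norm_iteratedFDeriv_smul_le (𝕜 := ℝ) hφ hV y (n := n) (by exact_mod_cast le_top)
  refine h.trans ?_
  calc ∑ i ∈ Finset.range (n + 1), (n.choose i : ℝ) * ‖iteratedFDeriv ℝ i φ y‖ * ‖iteratedFDeriv ℝ (n - i) V y‖
      ≤ ∑ i ∈ Finset.range (n + 1), (n.choose i : ℝ) * Mφ * K := by
        refine Finset.sum_le_sum fun i hi => ?_
        rw [Finset.mem_range] at hi
        have h1 := hφb i (by omega)
        have h2 := hVb (n - i) (by omega)
        have h3 : (0 : ℝ) ≤ n.choose i := by positivity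
        calc (n.choose i : ℝ) * ‖iteratedFDeriv ℝ i φ y‖ * ‖iteratedFDeriv ℝ (n - i) V y‖
            ≤ (n.choose i : ℝ) * Mφ * ‖iteratedFDeriv ℝ (n - i) V y‖ := by gcongr
          _ ≤ (n.choose i : ℝ) * Mφ * K := by gcongr
    _ = (∑ i ∈ Finset.range (n + 1), (n.choose i : ℝ)) * (Mφ * K) := by
        rw [Finset.sum_mul]; refine Finset.sum_congr rfl fun i _ => by ring
    _ = 2 ^ n * Mφ * K := by
        rw [← Nat.cast_sum, Nat.sum_range_choose]; push_cast; ring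

/-- **The annulus bound package**: at a point where `‖Dⁱφ‖ ≤ M_φ` and `‖DʲV‖ ≤ K` (`i, j ≤ 3`),
`‖V‖, ‖ΔV‖, ‖Δ(φV)‖, ‖DΔ(φV)‖ ≤ (3 + 24 M_φ) K`. [folklore] -/
theorem annulusBounds_of_iteratedFDeriv_le (hφ : ContDiff ℝ ∞ φ) (hV : ContDiff ℝ ∞ V) {Mφ K : ℝ}
    (hMφ : 0 ≤ Mφ) (hK : 0 ≤ K) {y : EuclideanSpace ℝ (Fin 3)}
    (hφb : ∀ i ≤ 3, ‖iteratedFDeriv ℝ i φ y‖ ≤ Mφ) (hVb : ∀ j ≤ 3, ‖iteratedFDeriv ℝ j V y‖ ≤ K) :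
    ‖V y‖ ≤ (3 + 24 * Mφ) * K ∧ ‖(Δ V) y‖ ≤ (3 + 24 * Mφ) * K ∧
      ‖(Δ (fun y => φ y • V y)) y‖ ≤ (3 + 24 * Mφ) * K ∧
      ‖fderiv ℝ (Δ (fun y => φ y • V y)) y‖ ≤ (3 + 24 * Mφ) * K := by
  have hw : ContDiff ℝ ∞ (fun y => φ y • V y) := hφ.smul hV
  have h0 : ‖V y‖ ≤ K := by rw [← norm_iteratedFDeriv_zero (𝕜 := ℝ)]; exact hVb 0 (by norm_num)
  have h2 : ‖(Δ V) y‖ ≤ 3 * K :=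
    (norm_laplacian_le_three_mul V y).trans (by linarith [hVb 2 (by norm_num)])
  have hw2 : ‖iteratedFDeriv ℝ 2 (fun y => φ y • V y) y‖ ≤ 2 ^ 2 * Mφ * K :=
    norm_iteratedFDeriv_cutoff_le hφ hV hMφ hφb hVb (by norm_num)
  have hw3 : ‖iteratedFDeriv ℝ 3 (fun y => φ y • V y) y‖ ≤ 2 ^ 3 * Mφ * K :=
    norm_iteratedFDeriv_cutoff_le hφ hV hMφ hφb hVb le_rfl
  have h3 : ‖(Δ (fun y => φ y • V y)) y‖ ≤ 12 * Mφ * K :=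
    (norm_laplacian_le_three_mul _ y).trans (by linarith)
  have h4 : ‖fderiv ℝ (Δ (fun y => φ y • V y)) y‖ ≤ 24 * Mφ * K :=
    (norm_fderiv_laplacian_le_three_mul hw y).trans (by linarith)
  have hMK : 0 ≤ Mφ * K := mul_nonneg hMφ hK
  refine ⟨by nlinarith, by nlinarith, by nlinarith, by nlinarith⟩

end Summit.NavierStokesRegularity.NavierStokesRegularity.Theorems.TypeITraceScarL3

end
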